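import Summits.QuantumFields.YangMills.Theorems.LuscherReductionTwistedTraceScalingSliceSmooth
import Mathlib.Analysis.Calculus.MeanValue
import Mathlib.Analysis.Calculus.ContDiff.RCLike
import HarnessLib

/-!
# Uniform second-order expansion of the relative coordinate in the gauge parameter at EVERY nearby base point `(w, c)`: the linear map of the Laplace evaluation
# (lane A of S-BASE, crux `TwistedTraceScaling` stmt-QuantumFields-20203, C4 INNER; design note `pub/ym-fleet/ym-luscher-20007-p1/COARSE-DESIGN.md` §23.8/§23.9 (N2))

The Gaussian evaluation of the Faddeev–Popov weight at a slice point `U* = orthoTube P(c*) w*` needs `relLinkVec(U*^{P∘ξ}) = w* + A_{(w*,c*)}ξ + O(‖ξ‖²)` with a constant UNIFORM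
in the base point and with the EXACT linear map `A_{(w*,c*)}` (the bilinear terms of the explicit expansions `…GaugeActionCovariant/Based` modify the linear map and must not be
treated as errors, §23.8).  THIS FILE gets both from smoothness (`…SliceSmooth`):
* ★★ `exists_taylor_two_of_contDiffAt` (abstract): `f : E × P → F` of class `C²` at `0` ⇒ `∃ M ε > 0`, `‖f(e,p) − f(0,p) − ∂_e f(0,p)·e‖ ≤ M‖e‖²` for `‖e‖, ‖p‖ < ε`, where
  `∂_e f(0,p) = fderiv f (0,p) ∘ inl` (the derivative is `C¹`, hence Lipschitz near `0`; mean value inequality on the segment);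
* ★★ `exists_taylor_two_relLinkVec_actCfg`: the instance `f = Φ̂ : (ξ, (w, c)) ↦ relLinkVec((orthoTube P(c) w)^{P∘ξ})` — `sliceLin (w,c) := fderiv Φ̂ (0,(w,c)) ∘ inl` is THE linear map of
  (N2) at base point `(w, c)` (at `(0,0)` it is `−∇` on mean-zero `ξ`, `…SliceMeets`), continuous in the base point (`continuousAt_sliceLin`).
HONEST FRAMING: textbook calculus for a stub of a child of the CONDITIONAL reduction route R2b1; no spectral claim; C4 OPEN; not a gap, not Clay.
-/

set_option autoImplicit false

noncomputable section

open Filter Topology Metric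
open Literature.MathematicalPhysics.QuantumFieldTheory
open Literature.MathematicalPhysics.QuantumLattice

namespace Summit.QuantumFields.YangMills.Theorems.FemtoTransferGap.TwoLattice.ConstTube

/-! ## §1 The abstract second-order expansion -/

section Abstract

variable {E P F : Type*} [NormedAddCommGroup E] [NormedSpace ℝ E] [NormedAddCommGroup P] [NormedSpace ℝ P] [NormedAddCommGroup F] [NormedSpace ℝ F]

/-- ★★ **Uniform second-order Taylor bound in the first variable** for a `C²` map on a product, at every nearby base point. [folklore] -/
theorem exists_taylor_two_of_contDiffAt {f : E × P → F} (hf : ContDiffAt ℝ 2 f 0) :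
    ∃ M ε : ℝ, 0 ≤ M ∧ 0 < ε ∧ ∀ (e : E) (p : P), ‖e‖ < ε → ‖p‖ < ε →
      ‖f (e, p) - f (0, p) - (fderiv ℝ f (0, p)) (e, 0)‖ ≤ M * ‖e‖ ^ 2 := by
  -- the derivative is `C¹`, hence Lipschitz near `0`; `f` is differentiable near `0`
  have h1 : ContDiffAt ℝ 1 (fderiv ℝ f) 0 := hf.fderiv_right (by norm_num)
  obtain ⟨K, t, ht, hLip⟩ := h1.exists_lipschitzOnWith
  have hdiff : ∀ᶠ z in 𝓝 (0 : E × P), DifferentiableAt ℝ f z := by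
    have h := hf.eventually (by simp)
    filter_upwards [h] with z hz using hz.differentiableAt (by simp)
  obtain ⟨ε, hε, hball⟩ := Metric.mem_nhds_iff.mp (Filter.inter_mem ht hdiff)
  refine ⟨K, ε, K.2, hε, fun e p he hp => ?_⟩
  -- points `(e', p)` with `‖e'‖ ≤ ‖e‖` are in the good ball
  have hmem : ∀ e' : E, ‖e'‖ ≤ ‖e‖ → ((e', p) : E × P) ∈ t ∧ DifferentiableAt ℝ f (e', p) := fun e' he' => by
    have : ((e', p) : E × P) ∈ ball (0 : E × P) ε := by
      rw [mem_ball, dist_zero_right, Prod.norm_def]; exact max_lt (lt_of_le_of_lt he' he) hp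
    exact hball this
  -- the auxiliary map `g(e') = f(e', p) − fderiv f (0,p) (e', 0)` and its derivative
  set Lp : E × P →L[ℝ] F := fderiv ℝ f (0, p) with hLp
  set g : E → F := fun e' => f (e', p) - Lp (e', 0) with hg
  have hincl : ∀ e' : E, HasFDerivAt (fun e'' : E => ((e'', p) : E × P)) (ContinuousLinearMap.inl ℝ E P) e' := fun e' =>
    (hasFDerivAt_id e').prodMk (hasFDerivAt_const p e')
  have hincl0 : ∀ e' : E, HasFDerivAt (fun e'' : E => ((e'', (0 : P)) : E × P)) (ContinuousLinearMap.inl ℝ E P) e' := fun e' =>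
    (hasFDerivAt_id e').prodMk (hasFDerivAt_const (0 : P) e')
  have hgder : ∀ e' ∈ closedBall (0 : E) ‖e‖,
      HasFDerivWithinAt g ((fderiv ℝ f (e', p) - Lp).comp (ContinuousLinearMap.inl ℝ E P)) (closedBall (0 : E) ‖e‖) e' := fun e' he' => by
    rw [mem_closedBall, dist_zero_right] at he'
    have hf' : HasFDerivAt (fun e'' : E => f (e'', p)) ((fderiv ℝ f (e', p)).comp (ContinuousLinearMap.inl ℝ E P)) e' :=
      ((hmem e' he').2.hasFDerivAt).comp e' (hincl e')
    have hL' : HasFDerivAt (fun e'' : E => Lp (e'', 0)) (Lp.comp (ContinuousLinearMap.inl ℝ E P)) e' :=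
      Lp.hasFDerivAt.comp e' (hincl0 e')
    have h := hf'.sub hL'
    rw [← ContinuousLinearMap.sub_comp] at h
    exact h.hasFDerivWithinAt
  -- its norm bound `K‖e‖` on the ball
  have hbound : ∀ e' ∈ closedBall (0 : E) ‖e‖, ‖(fderiv ℝ f (e', p) - Lp).comp (ContinuousLinearMap.inl ℝ E P)‖ ≤ K * ‖e‖ := fun e' he' => by
    rw [mem_closedBall, dist_zero_right] at he'
    have hd : dist (fderiv ℝ f (e', p)) (fderiv ℝ f (0, p)) ≤ K * dist ((e', p) : E × P) (0, p) :=
      hLip.dist_le_mul _ (hmem e' he').1 _ (hmem 0 (by simp)).1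
    have hdist : dist ((e', p) : E × P) (0, p) = ‖e'‖ := by
      rw [dist_eq_norm, Prod.mk_sub_mk, sub_zero, sub_self, Prod.norm_def]; simp
    rw [dist_eq_norm, hdist, ← hLp] at hd
    refine ContinuousLinearMap.opNorm_le_bound _ (by positivity) fun v => ?_
    rw [ContinuousLinearMap.comp_apply, ContinuousLinearMap.inl_apply]
    calc ‖(fderiv ℝ f (e', p) - Lp) (v, 0)‖ ≤ ‖fderiv ℝ f (e', p) - Lp‖ * ‖((v, 0) : E × P)‖ := ContinuousLinearMap.le_opNorm _ _
      _ ≤ (K * ‖e'‖) * ‖v‖ := by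
          rw [Prod.norm_def]; simp only [norm_zero, max_eq_left (norm_nonneg v)]
          exact mul_le_mul_of_nonneg_right hd (norm_nonneg _)
      _ ≤ K * ‖e‖ * ‖v‖ := by gcongr
  -- mean value inequality on the ball
  have hmv := (convex_closedBall (0 : E) ‖e‖).norm_image_sub_le_of_norm_hasFDerivWithin_le hgder hbound
    (mem_closedBall_self (norm_nonneg e)) (by rw [mem_closedBall, dist_zero_right])
  have hsimp : g e - g 0 = f (e, p) - f (0, p) - Lp (e, 0) := by
    simp only [hg]
    rw [show ((0 : E), (0 : P)) = (0 : E × P) from rfl, map_zero, sub_zero]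
    abel
  rw [hsimp, sub_zero] at hmv
  calc _ ≤ K * ‖e‖ * ‖e‖ := hmv
    _ = K * ‖e‖ ^ 2 := by ring

end Abstract

/-! ## §2 The instance: the relative coordinate of a gauge-transformed tube point -/

variable (L : ℕ) [NeZero L]

/-- The linear map of the Laplace evaluation at base point `p = (w, c)`: `sliceLin p = ∂_ξ Φ̂(0, p)`. [folklore] -/
def sliceLin (p : (Edge 3 L → Fin 3 → ℝ) × (Fin 3 → Fin 3 → ℝ)) : (Site 3 L → Fin 3 → ℝ) →L[ℝ] Stiff.LinkSpace L :=
  (fderiv ℝ (fun z : SliceParam L => relLinkVec L (actCfg L z)) (0, p)).comp (ContinuousLinearMap.inl ℝ _ _)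

/-- ★★ **UNIFORM SECOND-ORDER EXPANSION**: `‖relLinkVec((orthoTube P(c) w)^{P∘ξ}) − relLinkVec(orthoTube P(c) w) − sliceLin (w,c) ξ‖ ≤ M‖ξ‖²` for all `‖ξ‖, ‖(w,c)‖ < ε`. [folklore] -/
theorem exists_taylor_two_relLinkVec_actCfg : ∃ M ε : ℝ, 0 ≤ M ∧ 0 < ε ∧
    ∀ (ξ : Site 3 L → Fin 3 → ℝ) (p : (Edge 3 L → Fin 3 → ℝ) × (Fin 3 → Fin 3 → ℝ)), ‖ξ‖ < ε → ‖p‖ < ε →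
      ‖relLinkVec L (actCfg L (ξ, p)) - relLinkVec L (actCfg L (0, p)) - sliceLin L p ξ‖ ≤ M * ‖ξ‖ ^ 2 := by
  obtain ⟨M, ε, hM, hε, h⟩ := exists_taylor_two_of_contDiffAt (f := fun z : SliceParam L => relLinkVec L (actCfg L z)) (contDiffAt_relLinkVec_actCfg L (n := 2))
  exact ⟨M, ε, hM, hε, fun ξ p hξ hp => h ξ p hξ hp⟩

/-- The linear map depends continuously on the base point (the derivative of a `C²` map is continuous). [folklore] -/
theorem continuousAt_fderiv_relLinkVec_actCfg : ContinuousAt (fderiv ℝ (fun z : SliceParam L => relLinkVec L (actCfg L z))) 0 :=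
  (contDiffAt_relLinkVec_actCfg L (n := 2)).continuousAt_fderiv (by norm_num)

end Summit.QuantumFields.YangMills.Theorems.FemtoTransferGap.TwoLattice.ConstTube

end
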